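import Mathlib
import Summits.QuantumFields.YangMills.Theorems.ParabolicTrajectoryContinuumLimitOnTrajectoryStubOSLegsA_Lattice
import Summits.QuantumFields.YangMills.Theorems.ParabolicTrajectoryContinuumLimitOnTrajectoryStubOSLegsB_Limit
import Summits.QuantumFields.YangMills.Theorems.ParabolicTrajectoryContinuumLimitOnTrajectoryStubTranslB
import Summits.QuantumFields.YangMills.Theorems.LangevinControlUVOSLegsFromFemtoAndGapStubAssemblyCompactness
import Summits.QuantumFields.YangMills.Theorems.ConvexGribovBodyContinuumLegGivenGapStubArp
import Literature.Barriers.QuantumFields.UVStabilityNonUniqueness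
import HarnessLib

/-!
# `ContinuumLegGivenGap` (stmt-QuantumFields-15828), line `Sketch` (reshape 12): compactness extraction — `stub_extract`

Support file for the crux item stmt-QuantumFields-15828 (registered stub `stub_extract` of line `Sketch`, reshape 12:
the composition docks on route ParabolicTrajectory's proved one-field OS packaging `oneFieldOSLegs'`, which consumes
`ConvProducts r sch'` — full-sequence convergence of the canonical curvature `p`-point functions `curvNPoint r sch' k p f`
on every off-diagonal real product tensor).

`stub_extract` is the COMPACTNESS EXTRACTION: from the uniform-threshold plaquette-string bounds (UUVB, stated
unfolded in tree vocabulary `plaquetteObs`/`wilsonTorusMean`; converted by the landed `uuvb_of_unfolded`) pick, inside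
any infinitely-often visited set of steps `S`, a strictly increasing reindexing `ψ` with values in `S` along which
`ConvProducts` holds for the Literature sub-scheme `subScheme sch ψ hψ`. Proof:
(1) `Transl.norm_curvDistribution_le_of_uuvb` gives one Schwartz index `s`, constants `α, β` and ONE threshold `k₀`
with `‖curvDistribution r sch k p F‖ ≤ 6^p (α (p!)^β |F|_{p s})` for all `k ≥ k₀`, all `p`, all `F ∈ ⁰𝒮`;
(2) `Filter.extraction_of_frequently_atTop` enumerates `S ∩ [k₀, ∞)` by a strictly increasing `ψ₀`;
(3) route LangevinControlUV's compactness theorem `exists_subseq_clm_limit` (Cantor diagonal + `ε/3` + Hahn–Banach),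
applied to the continuous linear functionals `curvCLM r sch (ψ₀ j) p` on the submodules `offDiag p = ⁰𝒮`, gives a
further strictly increasing `φ₁` and limit functionals; (4) `ψ = ψ₀ ∘ φ₁`; (5) on a real product tensor
`curvDistribution = curvNPoint` (`curvDistribution_tensor`) and `curvNPoint r (subScheme sch ψ hψ) k = curvNPoint r sch (ψ k)`
definitionally, so real parts converge. [folklore]
-/

noncomputable section

namespace Summit.QuantumFields.YangMills.Theorems.ContinuumLegGivenGap

open scoped SchwartzMap
open Filter Topology MeasureTheory
open Literature.MathematicalPhysics.QuantumFieldTheory Literature.MathematicalPhysics.QuantumLattice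
  Literature.MathematicalPhysics.AQFT Literature.Probability.LatticeModels
open Summit.QuantumFields.YangMills.Cruxes.ContinuumLimitOnTrajectory.TwoOrbitSynchronisation
  (curvDistribution curvNPoint canon curvCLM curvCLM_apply curvDistribution_tensor ConvProducts UUVB PlaqIdx offDiag
   mem_offDiag)
open Summit.QuantumFields.YangMills.Cruxes.ContinuumLimitOnTrajectory.TwoOrbitSynchronisation.Transl
  (norm_curvDistribution_le_of_uuvb)
open Summit.QuantumFields.YangMills.Theorems.OSLegsFromFemtoAndGap (exists_subseq_clm_limit)
open Literature.Barriers.QuantumFields (subScheme)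

variable {G : Type} [Group G] [TopologicalSpace G] [IsTopologicalGroup G] [CompactSpace G]
  [MeasurableSpace G] [BorelSpace G]

/-- The canonical curvature `p`-point functions of a sub-scheme are those of the scheme, reindexed
(every field of `canon r (subScheme sch ψ hψ)` at step `k` is that of `canon r sch` at step `ψ k`). [folklore] -/
theorem curvNPoint_subScheme (r : LatticeRep G) (sch : SpeciesScheme (YMSpecies G)) (ψ : ℕ → ℕ)
    (hψ : StrictMono ψ) (k p : ℕ) (f : Fin p → 𝓢(EuclideanSpace ℝ (Fin 4), ℝ)) :
    curvNPoint r (subScheme sch ψ hψ) k p f = curvNPoint r sch (ψ k) p f :=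
  rfl

/-- **Uniform bound along an enumeration.** Under (UUVB), inside any infinitely-often visited set `S` there is a
strictly increasing `ψ₀` with values in `S` along which the canonical curvature functionals `curvCLM r sch (ψ₀ j) p`
are bounded on `⁰𝒮` by `C p · |F|_{p s}` for ALL `j` (the enumeration starts beyond the threshold of
`Transl.norm_curvDistribution_le_of_uuvb`; `C p = 6^p · max α 0 · (p!)^β ≥ 0`). [folklore] -/
theorem exists_enum_uniform_bound (r : LatticeRep G) (sch : SpeciesScheme (YMSpecies G)) (hU : UUVB r sch)
    (S : Set ℕ) (hS : ∃ᶠ k in atTop, k ∈ S) :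
    ∃ (ψ₀ : ℕ → ℕ) (s : ℕ) (C : ℕ → ℝ), StrictMono ψ₀ ∧ (∀ j, ψ₀ j ∈ S) ∧ (∀ p, 0 ≤ C p) ∧
      ∀ (p j : ℕ), ∀ F ∈ offDiag p, ‖curvCLM r sch (ψ₀ j) p F‖ ≤ C p * schwartzNorm (p * s) F := by
  obtain ⟨s, α, β, hk⟩ := norm_curvDistribution_le_of_uuvb r sch hU
  obtain ⟨k₀, hk₀⟩ := eventually_atTop.1 hk
  obtain ⟨ψ₀, hψ₀, hψ₀S⟩ := extraction_of_frequently_atTop (hS.and_eventually (eventually_ge_atTop k₀))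
  refine ⟨ψ₀, s, fun p => (Fintype.card PlaqIdx : ℝ) ^ p * (max α 0 * (p.factorial : ℝ) ^ β), hψ₀,
    fun j => (hψ₀S j).1, fun p => by positivity, fun p j F hF => ?_⟩
  rw [curvCLM_apply]
  refine (hk₀ (ψ₀ j) (hψ₀S j).2 p F hF).trans ?_
  have hsN : 0 ≤ schwartzNorm (p * s) F := schwartzNorm_nonneg _ _
  have hfac : 0 ≤ (p.factorial : ℝ) ^ β := by positivity
  have hcard : 0 ≤ (Fintype.card PlaqIdx : ℝ) ^ p := by positivity
  calc (Fintype.card PlaqIdx : ℝ) ^ p * (α * (p.factorial : ℝ) ^ β * schwartzNorm (p * s) F)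
      ≤ (Fintype.card PlaqIdx : ℝ) ^ p * (max α 0 * (p.factorial : ℝ) ^ β * schwartzNorm (p * s) F) :=
        mul_le_mul_of_nonneg_left
          (mul_le_mul_of_nonneg_right (mul_le_mul_of_nonneg_right (le_max_left α 0) hfac) hsN) hcard
    _ = (Fintype.card PlaqIdx : ℝ) ^ p * (max α 0 * (p.factorial : ℝ) ^ β) * schwartzNorm (p * s) F := by ring

/-- **Compactness extraction in route vocabulary.** Under (UUVB), inside any infinitely-often visited set `S` there is
a strictly increasing `ψ` with values in `S` along which `ConvProducts` holds for the sub-scheme `subScheme sch ψ hψ`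
(`exists_subseq_clm_limit` on `curvCLM` over `⁰𝒮`, then `curvDistribution_tensor` and real parts). [folklore] -/
theorem exists_subseq_convProducts_of_uuvb (r : LatticeRep G) (sch : SpeciesScheme (YMSpecies G)) (hU : UUVB r sch)
    (S : Set ℕ) (hS : ∃ᶠ k in atTop, k ∈ S) :
    ∃ (ψ : ℕ → ℕ) (hψ : StrictMono ψ), (∀ j, ψ j ∈ S) ∧ ConvProducts r (subScheme sch ψ hψ) := by
  obtain ⟨ψ₀, s, C, hψ₀, hψ₀S, hC, hT⟩ := exists_enum_uniform_bound r sch hU S hS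
  obtain ⟨φ₁, hφ₁, Slim, -, hconv⟩ :=
    exists_subseq_clm_limit (X := fun p : ℕ => Fin p → EuclideanSpace ℝ (Fin 4))
      (fun p j => curvCLM r sch (ψ₀ j) p) offDiag (fun p => p * s) C hC hT
  refine ⟨ψ₀ ∘ φ₁, hψ₀.comp hφ₁, fun j => hψ₀S (φ₁ j), fun p _ f hF => ?_⟩
  have hlim := hconv p (SchwartzMap.tensorFin p fun i => ofRealTest (f i)) hF
  refine ⟨(Slim p (SchwartzMap.tensorFin p fun i => ofRealTest (f i))).re,
    ((Complex.continuous_re.tendsto _).comp hlim).congr fun k => ?_⟩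
  simp only [Function.comp_apply, curvCLM_apply,
    curvDistribution_tensor r sch (ψ₀ (φ₁ k)) p (isTensorOf_tensorFin fun i => ofRealTest (f i)), Complex.ofReal_re]
  rfl

/-- `stub_extract` — **compactness extraction** (registered stub of stmt-QuantumFields-15828, line `Sketch`, reshape 12):
for a scheme with the uniform-threshold plaquette-string bounds (UUVB) (the clause reads only `a, β, L`), inside ANY
infinitely-often visited set of steps `S` there is a strictly increasing reindexing `ψ` with values in `S` along which
every canonical curvature `p`-point function converges on every off-diagonal real product tensor — `ConvProducts` for
the sub-scheme `subScheme sch ψ hψ` (route LangevinControlUV's `exists_subseq_clm_limit` applied to route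
ParabolicTrajectory's `curvCLM`, with the uniform-threshold bound `Transl.norm_curvDistribution_le_of_uuvb`). [folklore] -/
theorem stub_extract :
    ∀ (G : Type) [Group G] [TopologicalSpace G] [IsTopologicalGroup G] [CompactSpace G]
      [MeasurableSpace G] [BorelSpace G] (r : LatticeRep G) (sch : SpeciesScheme (YMSpecies G)),
      (∃ (s : ℕ) (α β' : ℝ), ∀ᶠ k in atTop, ∀ (p : ℕ) (q : Fin p → {q : Fin 4 × Fin 4 // q.1 < q.2})
        (F : SchwartzMap (Fin p → EuclideanSpace ℝ (Fin 4)) ℂ), IsOffDiagonal F →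
        ‖∫ U : GaugeConfig 4 (sch.side k) G, ∑ x : Fin p → ↥(box 4 (sch.L k)),
            F (fun i => sch.a k • siteToE ↑(x i)) *
              ∏ i, ((plaquetteObs r.ρ 0 (q i).1.1 (q i).1.2 (configShift (-↑(x i)) (torusLift (sch.side k) U)) -
                wilsonTorusMean r.ρ (sch.β k) (sch.L k) (plaquetteObs r.ρ 0 (q i).1.1 (q i).1.2) : ℝ) : ℂ)
            ∂(wilsonMeasure r.ρ (sch.β k))‖ ≤ α * (p.factorial : ℝ) ^ β' * schwartzNorm (p * s) F) →
      ∀ S : Set ℕ, (∃ᶠ k in atTop, k ∈ S) →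
        ∃ (ψ : ℕ → ℕ) (hψ : StrictMono ψ), (∀ j, ψ j ∈ S) ∧
          Summit.QuantumFields.YangMills.Cruxes.ContinuumLimitOnTrajectory.TwoOrbitSynchronisation.ConvProducts r
            (Literature.Barriers.QuantumFields.subScheme sch ψ hψ) := by
  intro G _ _ _ _ _ _ r sch hUUVB S hS
  exact exists_subseq_convProducts_of_uuvb r sch (uuvb_of_unfolded r sch hUUVB) S hS

end Summit.QuantumFields.YangMills.Theorems.ContinuumLegGivenGap

end
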